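import Literature.NumberTheory.Automorphic.UnitaryCyclicCentralizerCompactNonsplit     -- ★ B-p10 (E4′): `eq_smul_one_add_smul_of_commute`, one-place model pattern, `valuation_eq_one_of_galAdicCompletionMap_mul_self` (via imports)
import Literature.NumberTheory.Automorphic.UnitaryEllipticCentralizerCompactNonsplit   -- ★ B-p10 (E4): carrier lemmas (`map_conjLocal_transpose_localForm`, `isUnit_det_localForm`, `LocalRing.isField_of_smul_eq`), frame algebra
import Literature.NumberTheory.Automorphic.AnisotropicUnitaryGroupCompactLocal          -- ★ `exists_v_eq_exp_neg_one_adicCompletion`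
import Literature.NumberTheory.Automorphic.AdicCompletionLocalField                    -- ★ `IsNonarchimedeanLocalField (w.adicCompletion L)`
import Literature.NumberTheory.Automorphic.LocalUnitaryGroupCongr                      -- ★ `localNonsplitEquiv`
import HarnessLib

/-!
# The centraliser of a regular element of `U(J)(L⁺_v)` in rank 2 at a non-split place: COMPACT for the elliptic torus `(EK)¹` (no root in `L_w`; no ramification
# or parity hypothesis), NOT compact for the split torus `E^×` (Rogawski 1990, §3.6; Platonov–Rapinchuk 1994, §3.3)

Topic `NumberTheory/Automorphic`; namespace `Literature.NumberTheory.Automorphic.UnitaryGroup`.  THEOREMS ONLY (no definition, no instance, no notation, no named fact, no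
`sorry`).  Cell `pub/hodgecm-mathlib` (D-0151), crux H413 = `stmt-HodgeConjecture-24833`, floor-2 line «N6nsGerm», binder `hcnt` (CNT) of ★ B-p08
`exists_nhds_finsum_side_eq_stableOrbitalIntegralRel_of_compact_dock` (:202–:211: its clauses (3)(4) are conditioned on `CompactSpace Z(γ_H.1)` ∕ its negation); LEAD F0P3a-plan (g9)
WORD T8-120 «(CNT-b) BY NAME», census `B-provers/B-p04/g34/CENSUS-CNTb-CompactSideCount.B-p04g34.md` §2 (n1)(n2); seat B-p04 (g34).  HONEST LABEL: HC_CM is proved only modulo the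
printed citations until rung 0 closes; this file is unconditional and pays no printed letter.

THE MATHEMATICS.  `L` CM, `v` a finite place of `L⁺` NOT split in `L` (`c • w = w`, `L_v = L_w` a field), `J ∈ M₂(L)` hermitian with `det J ≠ 0`, `γ ∈ U(J)(L⁺_v) ⊂ GL₂(L_w)` regular.
* §1 TYPE (2) (`χ_γ` without root in `L_w`; the torus `(EK)¹`): `Z_{GL₂}(γ) = {a + bγ}` (`γ₁₀ ≠ 0`, ★ `eq_smul_one_add_smul_of_commute`); on `U(J)` `|det(a + bγ)| = 1`, and the binary
  QUADRATIC form `(a, b) ↦ det(a + bγ) = a² + ab·tr γ + b²·det γ` is ANISOTROPIC (a zero `(a, b)`, `b ≠ 0`, would make `−a∕b` a root of `χ_γ`), hence COERCIVE (★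
  `HermitianLattice.exists_forall_v_sq_le_v_hermForm_self` with `σ = id`): `|a|, |b| ≤ q^m`.  So `Z(γ)` is the continuous image of a closed subset of a compact box (★
  `compactSpace_integer_adicCompletion`, ★ `isCompact_setOf_v_le_exp_int`) — in the one-place model `U(σ_w, J_w)` — and compact in `U(J)(L⁺_v)` along ★ `localNonsplitEquiv`.  This is
  ★ B-p10 `compactSpace_centralizer_of_not_exists_isRoot` WITHOUT its hypotheses `hunr`, `2 ∈ 𝒪^×`, `hint`, `|disc| = q^{−(2N+1)}` (there the bound came from the odd discriminant).
* §2 SPLIT TYPE (`γ P = P·diag(u)`, `u₀ ≠ u₁`, `σ(u₀)u₀ ≠ 1`; the torus `E^× ⊂ U(1,1)`): the frame Gram matrix `J_P` has ZERO diagonal (`(σ(uᵢ)uᵢ − 1)·(J_P)ᵢᵢ = 0`, and `σ(u₁)u₁ ≠ 1`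
  too since `N(det γ) = 1`), so `P·diag(t, σ(t)⁻¹)·P⁻¹ ∈ Z_{U(J)}(γ)` for EVERY `t ∈ L_w^×`; the continuous map `z ↦ (P⁻¹ z P)₀₀` sends `Z(γ)` onto a set containing `L_w ∖ {0}`, and a
  compact `Z(γ)` would make `L_w = K ∪ {0}` compact — a non-archimedean local field is not ([WeilBNT1967, Ch. I §2]; ★ `AdicCompletionLocalField` instances).

References: [Rogawski1990] §3.5 p. 29, §3.6 pp. 31–32 · [PlatonovRapinchuk1994] §3.3 (anisotropic tori over local fields are compact; split tori are not) · [WeilBNT1967] Ch. I §2,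
Ch. II §1–2.
-/

set_option autoImplicit false

noncomputable section

open NumberField IsDedekindDomain Matrix Topology Polynomial
open scoped Matrix MatrixGroups Valued

namespace Literature.NumberTheory.Automorphic.UnitaryGroup

open Literature.NumberTheory.Rogawski1990
open Literature.AlgebraicGeometry.ShimuraVarieties (unitaryGroup)

section Scalar

/-- In `ℤᵐ⁰`: `x · x ≤ exp m` (`m : ℕ`) forces `x ≤ exp m`. [folklore] -/
private theorem le_exp_of_mul_self_le {x : WithZero (Multiplicative ℤ)} {m : ℕ} (h : x * x ≤ WithZero.exp (m : ℤ)) : x ≤ WithZero.exp (m : ℤ) := by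
  rcases le_or_gt x 1 with h1 | h1
  · calc x ≤ 1 := h1
      _ = WithZero.exp 0 := WithZero.exp_zero.symm
      _ ≤ WithZero.exp (m : ℤ) := WithZero.exp_le_exp.2 (by positivity)
  · calc x = x * 1 := (mul_one x).symm
      _ ≤ x * x := mul_le_mul_right h1.le x
      _ ≤ WithZero.exp (m : ℤ) := h

/-- In `ℤᵐ⁰`: `x · x = 1` forces `x = 1`. [folklore] -/
private theorem eq_one_of_mul_self_eq_one {x : WithZero (Multiplicative ℤ)} (h : x * x = 1) : x = 1 := by
  rcases lt_trichotomy x 1 with h1 | h1 | h1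
  · exfalso
    have : x * x ≤ x * 1 := mul_le_mul_right h1.le x
    rw [h, mul_one] at this
    exact absurd this (not_le.2 h1)
  · exact h1
  · exfalso
    have : x * 1 ≤ x * x := mul_le_mul_right h1.le x
    rw [h, mul_one] at this
    exact absurd this (not_le.2 h1)

variable {K : Type*} [Field K] [ValuativeRel K] [TopologicalSpace K] [IsNonarchimedeanLocalField K]

/-- A non-archimedean local field is not compact (the balls `{v < t^k}`, `t > 1`, cover with no finite subcover; local copy as in ★ `LocalUnitaryGroupNoncompactRankTwo`).
[cite: WeilBNT1967, Ch. I §2] -/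
private theorem not_compactSpace_of_isNonarchimedeanLocalField'' : ¬ CompactSpace K := by
  intro hF
  obtain ⟨γ, hγ0, hγ1⟩ := ValuativeRel.IsNontrivial.exists_lt_one (R := K)
  have ht : 1 < γ⁻¹ := (one_lt_inv₀ hγ0).2 hγ1
  have ht0 : γ⁻¹ ≠ 0 := inv_ne_zero hγ0.ne'
  set U : ℕ → Set K := fun k => {x | ValuativeRel.valuation K x < γ⁻¹ ^ k} with hU
  have hUo : ∀ k, IsOpen (U k) := fun k => by
    rw [isOpen_iff_mem_nhds]
    intro x hx
    rw [IsValuativeTopology.mem_nhds_iff']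
    refine ⟨Units.mk0 (γ⁻¹ ^ k) (pow_ne_zero _ ht0), fun z hz => ?_⟩
    have hz' : ValuativeRel.valuation K (z - x) < γ⁻¹ ^ k := by simpa using hz
    have hx' : ValuativeRel.valuation K x < γ⁻¹ ^ k := hx
    show ValuativeRel.valuation K z < γ⁻¹ ^ k
    calc ValuativeRel.valuation K z = ValuativeRel.valuation K (z - x + x) := by rw [sub_add_cancel]
      _ ≤ max (ValuativeRel.valuation K (z - x)) (ValuativeRel.valuation K x) := Valuation.map_add _ _ _
      _ < γ⁻¹ ^ k := max_lt hz' hx'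
  have hcov : (Set.univ : Set K) ⊆ ⋃ k, U k := fun x _ => by
    obtain ⟨k, hk⟩ := MulArchimedean.arch (ValuativeRel.valuation K x) ht
    exact Set.mem_iUnion.2 ⟨k + 1, lt_of_le_of_lt hk (pow_lt_pow_right₀ ht (Nat.lt_succ_self k))⟩
  obtain ⟨T, hT⟩ := (@isCompact_univ K _ hF).elim_finite_subcover U hUo hcov
  have hmono : ∀ {k l : ℕ}, k ≤ l → U k ⊆ U l := fun hkl x hx =>
    lt_of_lt_of_le hx (pow_le_pow_right₀ ht.le hkl)
  obtain ⟨g, hg⟩ := ValuativeRel.valuation_surjective (γ⁻¹ ^ (T.sup id) : ValuativeRel.ValueGroupWithZero K)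
  have hmem := hT (Set.mem_univ g)
  simp only [Set.mem_iUnion] at hmem
  obtain ⟨k, hk, hgk⟩ := hmem
  have hlt : ValuativeRel.valuation K g < γ⁻¹ ^ (T.sup id) := hmono (Finset.le_sup (f := id) hk) hgk
  rw [hg] at hlt
  exact lt_irrefl _ hlt

end Scalar

/-! ## §1 Type (2): the centraliser is compact (no root) — generic valued field, then `U(J)(L⁺_v)` -/

section Generic

/-- For `z` with `ᵗσ(z) G z = G` and `det G ≠ 0`: `σ(det z) · det z = 1`. [folklore] -/
private theorem map_det_mul_det_eq_one_of_unitary {K : Type*} [Field K] (σ : K →+* K) {n : Type*} [Fintype n] [DecidableEq n] {G : Matrix n n K} (hG : G.det ≠ 0)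
    {z : Matrix n n K} (hz : (z.map σ)ᵀ * G * z = G) : σ z.det * z.det = 1 := by
  have h := congrArg Matrix.det hz
  rw [Matrix.det_mul, Matrix.det_mul, Matrix.det_transpose, ← RingHom.mapMatrix_apply, ← RingHom.map_det] at h
  have h2 : (σ z.det * z.det) * G.det = 1 * G.det := by rw [one_mul]; linear_combination h
  exact mul_right_cancel₀ hG h2

variable {K : Type*} [Field K] [Valued K (WithZero (Multiplicative ℤ))]

/-- **COMPACT CENTRALISER OF A TYPE-(2) ELEMENT — generic valued field** (`𝒪` compact, a uniformizer `ϖ`, `σ` preserving `v`, `2 ≠ 0`, `G ∈ M₂(K)` with `det G ≠ 0`): for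
`u ∈ U(σ, G)` whose characteristic polynomial has NO ROOT in `K`, `Z(u)` is compact — the continuous image of the compact set `{(a, b) : |a|, |b| ≤ q^m, a + bu unitary}`, `m`
the coercivity exponent of the anisotropic quadratic form `det(a + bu)`. [cite: Rogawski1990, §3.6 pp. 31–32] [cite: PlatonovRapinchuk1994, §3.3] [cite: WeilBNT1967, Ch. II §1 Prop. 2] -/
theorem isCompact_centralizer_unitaryGroupOfForm_of_not_exists_isRoot [CompactSpace 𝒪[K]] {ϖ : K} (hϖ : Valued.v ϖ = WithZero.exp (-1 : ℤ))
    (σ : K →+* K) (hσv : ∀ x, Valued.v (σ x) = Valued.v x) (h2 : (2 : K) ≠ 0) {G : Matrix (Fin 2) (Fin 2) K} (hG : G.det ≠ 0)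
    (u : unitaryGroupOfForm σ G) (hirr : ¬ ∃ x : K, (((u : GL (Fin 2) K) : Matrix (Fin 2) (Fin 2) K).charpoly).IsRoot x) :
    IsCompact ((Subgroup.centralizer ({u} : Set (unitaryGroupOfForm σ G)) : Subgroup (unitaryGroupOfForm σ G)) : Set (unitaryGroupOfForm σ G)) := by
  classical
  have hσc : Continuous σ := HermitianLattice.continuous_of_forall_v_eq hσv
  obtain ⟨g, hg⟩ : ∃ g : Matrix (Fin 2) (Fin 2) K, ((u : GL (Fin 2) K) : Matrix (Fin 2) (Fin 2) K) = g := ⟨_, rfl⟩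
  rw [hg] at hirr
  have hgU : (g.map σ)ᵀ * G * g = G := by
    rw [← hg]
    exact (mem_unitaryGroupOfForm_iff (σ := σ) (J := G) (g := (u : GL (Fin 2) K))).1 u.2
  have hg10 : g 1 0 ≠ 0 := fun h10 => hirr ⟨g 0 0, by
    rw [Polynomial.IsRoot, Matrix.charpoly_fin_two, Matrix.trace_fin_two, Matrix.det_fin_two, h10]
    simp; ring⟩
  -- the parametrisation `(a, b) ↦ a + b g` and the quadratic form `det(a + b g)`
  set M : K × K → Matrix (Fin 2) (Fin 2) K := fun p => p.1 • (1 : Matrix (Fin 2) (Fin 2) K) + p.2 • g with hM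
  have hMc : Continuous M := (continuous_fst.smul continuous_const).add (continuous_snd.smul continuous_const)
  have hMdet : ∀ a b : K, (M (a, b)).det = a ^ 2 + a * b * g.trace + b ^ 2 * g.det := fun a b => by
    simp only [hM, Matrix.det_fin_two, Matrix.trace_fin_two, Matrix.add_apply, Matrix.smul_apply, Matrix.one_apply_eq, Matrix.one_apply_ne (by decide : (0 : Fin 2) ≠ 1),
      Matrix.one_apply_ne (by decide : (1 : Fin 2) ≠ 0), smul_eq_mul]
    ring
  set Hq : Matrix (Fin 2) (Fin 2) K := !![2, g.trace; g.trace, 2 * g.det] with hHq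
  have hQ : ∀ x : Fin 2 → K, hermForm (RingHom.id K) Hq x x = 2 * (M (x 0, x 1)).det := fun x => by
    rw [hMdet, hermForm_apply, hHq]
    simp [Matrix.mulVec, dotProduct, Fin.sum_univ_two]
    ring
  have hanis : ∀ x : Fin 2 → K, hermForm (RingHom.id K) Hq x x = 0 → x = 0 := by
    intro x hx
    rw [hQ, hMdet] at hx
    have hx' : x 0 ^ 2 + x 0 * x 1 * g.trace + x 1 ^ 2 * g.det = 0 := (mul_eq_zero.1 hx).resolve_left h2
    by_cases hb : x 1 = 0
    · rw [hb] at hx'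
      have ha : x 0 = 0 := by simpa using hx'
      funext i; fin_cases i
      · exact ha
      · exact hb
    · exfalso
      refine hirr ⟨-(x 0 / x 1), ?_⟩
      rw [Polynomial.IsRoot, Matrix.charpoly_fin_two]
      simp only [eval_add, eval_sub, eval_mul, eval_pow, eval_X, eval_C]
      field_simp
      linear_combination hx'
  obtain ⟨m, hm⟩ := HermitianLattice.exists_forall_v_sq_le_v_hermForm_self (n := Fin 2) (σ := RingHom.id K) (H := Hq) hϖ (fun _ => rfl) hanis
  have hv2 : Valued.v (2 : K) ≤ 1 := by
    rw [show (2 : K) = 1 + 1 by norm_num]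
    exact (Valued.v.map_add 1 1).trans (by rw [Valued.v.map_one, max_self])
  have hbd : ∀ a b : K, Valued.v ((M (a, b)).det) = 1 → Valued.v a ≤ WithZero.exp (m : ℤ) ∧ Valued.v b ≤ WithZero.exp (m : ℤ) := by
    intro a b h1
    have hx := fun i => hm ![a, b] i
    have hdet' : Valued.v (hermForm (RingHom.id K) Hq ![a, b] ![a, b]) ≤ 1 := by
      rw [hQ, Valued.v.map_mul]
      calc Valued.v (2 : K) * Valued.v (M (a, b)).det = Valued.v (2 : K) * 1 := by
            rw [h1]
        _ ≤ 1 * 1 := mul_le_mul_left hv2 _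
        _ = 1 := one_mul _
    have hem : WithZero.exp (-(m : ℤ)) * WithZero.exp (m : ℤ) = 1 := by rw [← WithZero.exp_add, neg_add_cancel, WithZero.exp_zero]
    have key : ∀ y : K, Valued.v y * Valued.v y * WithZero.exp (-(m : ℤ)) ≤ 1 → Valued.v y ≤ WithZero.exp (m : ℤ) := fun y hy => by
      apply le_exp_of_mul_self_le
      calc Valued.v y * Valued.v y = Valued.v y * Valued.v y * WithZero.exp (-(m : ℤ)) * WithZero.exp (m : ℤ) := by rw [mul_assoc, hem, mul_one]
        _ ≤ 1 * WithZero.exp (m : ℤ) := mul_le_mul_left hy _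
        _ = WithZero.exp (m : ℤ) := one_mul _
    exact ⟨key a ((hx 0).trans hdet'), key b ((hx 1).trans hdet')⟩
  set S : Set (K × K) := ({x : K | Valued.v x ≤ WithZero.exp (m : ℤ)} ×ˢ {x : K | Valued.v x ≤ WithZero.exp (m : ℤ)}) ∩ {p | ((M p).map σ)ᵀ * G * M p = G} with hS
  have hSc : IsCompact S := by
    refine ((HermitianLattice.isCompact_setOf_v_le_exp_int hϖ m).prod (HermitianLattice.isCompact_setOf_v_le_exp_int hϖ m)).inter_right ?_
    exact isClosed_eq (((hMc.matrix_map hσc).matrix_transpose.matrix_mul continuous_const).matrix_mul hMc) continuous_const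
  haveI : CompactSpace S := isCompact_iff_compactSpace.1 hSc
  have hJinv : G⁻¹ * G = 1 := Matrix.nonsing_inv_mul G (Ne.isUnit hG)
  have hinv : ∀ p : S, G⁻¹ * ((M p.1).map σ)ᵀ * G * M p.1 = 1 := fun p => by
    calc G⁻¹ * ((M p.1).map σ)ᵀ * G * M p.1 = G⁻¹ * (((M p.1).map σ)ᵀ * G * M p.1) := by simp only [Matrix.mul_assoc]
      _ = 1 := by rw [p.2.2, hJinv]
  let φGL : S → GL (Fin 2) K := fun p => ⟨M p.1, G⁻¹ * ((M p.1).map σ)ᵀ * G, mul_eq_one_comm.1 (hinv p), hinv p⟩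
  have hφGLc : Continuous φGL := by
    refine Units.continuous_iff.2 ⟨?_, ?_⟩
    · show Continuous fun p : S => M p.1
      exact hMc.comp continuous_subtype_val
    · show Continuous fun p : S => G⁻¹ * ((M p.1).map σ)ᵀ * G
      exact (continuous_const.matrix_mul ((hMc.comp continuous_subtype_val).matrix_map hσc).matrix_transpose).matrix_mul continuous_const
  let φ : S → (unitaryGroupOfForm σ G) := fun p => ⟨φGL p, (mem_unitaryGroupOfForm_iff (σ := σ) (J := G)).2 p.2.2⟩
  have hφc : Continuous φ := hφGLc.subtype_mk _
  have hrange : Set.range φ = ((Subgroup.centralizer ({u} : Set (unitaryGroupOfForm σ G)) : Subgroup (unitaryGroupOfForm σ G)) : Set (unitaryGroupOfForm σ G)) := by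
    ext z
    simp only [Set.mem_range, SetLike.mem_coe, Subgroup.mem_centralizer_singleton_iff]
    constructor
    · rintro ⟨p, rfl⟩
      apply Subtype.ext; apply Units.ext
      show M p.1 * ((u : GL (Fin 2) K) : Matrix (Fin 2) (Fin 2) K) = ((u : GL (Fin 2) K) : Matrix (Fin 2) (Fin 2) K) * M p.1
      rw [hg, hM]
      simp only [Matrix.add_mul, Matrix.mul_add, Matrix.smul_mul, Matrix.mul_smul, Matrix.one_mul, Matrix.mul_one]
    · intro hz
      have hcomm : Commute ((z : GL (Fin 2) K) : Matrix (Fin 2) (Fin 2) K) g := by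
        rw [← hg]; exact congrArg (fun x : (unitaryGroupOfForm σ G) => ((x : GL (Fin 2) K) : Matrix (Fin 2) (Fin 2) K)) hz
      have hzU : (((z : GL (Fin 2) K) : Matrix (Fin 2) (Fin 2) K).map σ)ᵀ * G * ((z : GL (Fin 2) K) : Matrix (Fin 2) (Fin 2) K) = G :=
        (mem_unitaryGroupOfForm_iff (σ := σ) (J := G) (g := (z : GL (Fin 2) K))).1 z.2
      set a : K := ((z : GL (Fin 2) K) : Matrix (Fin 2) (Fin 2) K) 0 0 - ((z : GL (Fin 2) K) : Matrix (Fin 2) (Fin 2) K) 1 0 / g 1 0 * g 0 0 with ha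
      set b : K := ((z : GL (Fin 2) K) : Matrix (Fin 2) (Fin 2) K) 1 0 / g 1 0 with hb
      have hzab : ((z : GL (Fin 2) K) : Matrix (Fin 2) (Fin 2) K) = M (a, b) := eq_smul_one_add_smul_of_commute g _ hg10 hcomm
      have hdet1 : Valued.v ((M (a, b)).det) = 1 := by
        have h1 := map_det_mul_det_eq_one_of_unitary σ hG hzU
        rw [hzab] at h1
        have h3 : Valued.v ((M (a, b)).det) * Valued.v ((M (a, b)).det) = 1 := by
          have h4 := congrArg Valued.v h1
          rwa [Valued.v.map_mul, hσv, Valued.v.map_one] at h4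
        exact eq_one_of_mul_self_eq_one h3
      obtain ⟨hva, hvb⟩ := hbd a b hdet1
      refine ⟨⟨(a, b), ⟨⟨hva, hvb⟩, show ((M (a, b)).map _)ᵀ * _ * M (a, b) = _ by rw [← hzab]; exact hzU⟩⟩, ?_⟩
      apply Subtype.ext; apply Units.ext
      exact hzab.symm
  rw [← hrange]
  exact isCompact_range hφc

end Generic

section CM

variable (L : Type) [Field L] [NumberField L] [IsCMField L] (v : HeightOneSpectrum (𝓞 ↥(maximalRealSubfield L)))
  (w : PlacesOver L v) (hw : IsCMField.complexConj L • w.1 = w.1) {J : Matrix (Fin 2) (Fin 2) L}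

include hw in
/-- **THE CENTRALISER OF A TYPE-(2) ELEMENT OF `U(J)(L⁺_v)` IS COMPACT** — general form (rank 2, `det J ≠ 0`, `v` non-split; ONLY hypothesis: `χ_γ` read at the place `w ∣ v`
has no root in `L_w`).  §1 in the one-place model `U(σ_w, J_w)(L_w)` (`𝒪_w` compact ★ `compactSpace_integer_adicCompletion`, `σ_w` preserves `v` ★ `valued_galAdicCompletionMap`),
transported along ★ `localNonsplitEquiv`.  [cite: Rogawski1990, §3.6 pp. 31–32] [cite: PlatonovRapinchuk1994, §3.3] -/
theorem compactSpace_centralizer_cmDatum_two_of_not_exists_isRoot (hdet : J.det ≠ 0) (γ : (cmDatum L 2 J).Local v)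
    (hirr : ¬ ∃ x : (w.1.adicCompletion L), (((((γ.val : GL (Fin 2) (LocalRing L v)) : Matrix (Fin 2) (Fin 2) (LocalRing L v)).map
      (Pi.evalRingHom (fun w' : PlacesOver L v => w'.1.adicCompletion L) w))).charpoly).IsRoot x) :
    CompactSpace (Subgroup.centralizer ({γ} : Set ((cmDatum L 2 J).Local v))) := by
  have hc1 : IsCMField.complexConj L ≠ 1 := IsCMField.complexConj_ne_one L
  haveI := compactSpace_integer_adicCompletion L w.1
  haveI : CharZero (w.1.adicCompletion L) := charZero_of_injective_algebraMap (algebraMap L _).injective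
  obtain ⟨ϖ, hϖ⟩ := exists_v_eq_exp_neg_one_adicCompletion (E := L) w.1
  have hJwd : (placeForm J w.1).det ≠ 0 := by
    rw [placeForm, ← RingHom.mapMatrix_apply, ← RingHom.map_det]
    exact (map_ne_zero_iff _ (algebraMap L (w.1.adicCompletion L)).injective).2 hdet
  have hcoe : ((((localNonsplitEquiv (IsCMField.complexConj L) J hc1 w hw) γ :
      (unitaryGroupOfForm (galAdicCompletionMap (L := L) (IsCMField.complexConj L) hw) (placeForm J w.1))) : GL (Fin 2) (w.1.adicCompletion L)) :
        Matrix (Fin 2) (Fin 2) (w.1.adicCompletion L)) = (((γ.val : GL (Fin 2) (LocalRing L v)) : Matrix (Fin 2) (Fin 2) (LocalRing L v)).map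
          (Pi.evalRingHom (fun w' : PlacesOver L v => w'.1.adicCompletion L) w)) := rfl
  have hK := isCompact_centralizer_unitaryGroupOfForm_of_not_exists_isRoot hϖ (galAdicCompletionMap (L := L) (IsCMField.complexConj L) hw)
    (valued_galAdicCompletionMap (L := L) (IsCMField.complexConj L) hw) two_ne_zero hJwd ((localNonsplitEquiv (IsCMField.complexConj L) J hc1 w hw) γ)
    (by rw [hcoe]; exact hirr)
  haveI : CompactSpace (Subgroup.centralizer ({(localNonsplitEquiv (IsCMField.complexConj L) J hc1 w hw) γ} :
      Set (unitaryGroupOfForm (galAdicCompletionMap (L := L) (IsCMField.complexConj L) hw) (placeForm J w.1)))) := isCompact_iff_compactSpace.1 hK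
  have hiff : ∀ x : (cmDatum L 2 J).Local v, x ∈ Subgroup.centralizer ({γ} : Set ((cmDatum L 2 J).Local v)) ↔
      (localNonsplitEquiv (IsCMField.complexConj L) J hc1 w hw) x ∈ Subgroup.centralizer ({(localNonsplitEquiv (IsCMField.complexConj L) J hc1 w hw) γ} :
        Set (unitaryGroupOfForm (galAdicCompletionMap (L := L) (IsCMField.complexConj L) hw) (placeForm J w.1))) := fun x => by
    rw [Subgroup.mem_centralizer_singleton_iff, Subgroup.mem_centralizer_singleton_iff, ← map_mul, ← map_mul,
      (localNonsplitEquiv (IsCMField.complexConj L) J hc1 w hw).injective.eq_iff]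
    exact Iff.rfl
  exact (((localNonsplitEquiv (IsCMField.complexConj L) J hc1 w hw).toHomeomorph).subtype hiff).symm.compactSpace

/-! ## §2 Split type: the centraliser is NOT compact -/

include hw in
/-- **THE CENTRALISER OF A SPLIT REGULAR ELEMENT OF `U(J)(L⁺_v)` IS NOT COMPACT** (rank 2, `J` hermitian with `det J ≠ 0`, `v` non-split): if `γ P = P · diag(u)` with
`σ(u₀) u₀ ≠ 1` (the split torus `E^×`; then `σ(u₁) u₁ ≠ 1` too), then `Z(γ)` contains `P · diag(t, σ(t)⁻¹) · P⁻¹` for every `t ∈ L_v^×` and maps continuously onto a subset of `L_w` containing `L_w ∖ {0}`.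
[cite: Rogawski1990, §3.6 p. 31] [cite: PlatonovRapinchuk1994, §3.3] [cite: WeilBNT1967, Ch. I §2] -/
theorem not_compactSpace_centralizer_cmDatum_two_of_split_eigenframe (hJ : (J.map (cmConjRingHom L))ᵀ = J) (hdet : J.det ≠ 0) (γ : (cmDatum L 2 J).Local v)
    {P : GL (Fin 2) (LocalRing L v)} {u : Fin 2 → LocalRing L v} (hP : γ.val.val * P.val = P.val * diagonal u)
    (h0 : conjLocal L (IsCMField.complexConj L) v (u 0) * u 0 ≠ 1) :
    ¬ CompactSpace (Subgroup.centralizer ({γ} : Set ((cmDatum L 2 J).Local v))) := by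
  classical
  intro hZ
  have hc1 : IsCMField.complexConj L ≠ 1 := IsCMField.complexConj_ne_one L
  letI : Field (LocalRing L v) := (LocalRing.isField_of_smul_eq (IsCMField.complexConj L) hc1 w hw).toField
  set σ := conjLocal L (IsCMField.complexConj L) v with hσdef
  set Jv : Matrix (Fin 2) (Fin 2) (LocalRing L v) := (adelicForm L 2 J).map (adeleToLocal L v) with hJv
  have hJvh : (Jv.map σ)ᵀ = Jv := map_conjLocal_transpose_localForm L 2 J v hJ
  have hJvd : IsUnit Jv.det := isUnit_det_localForm L 2 J v hdet
  have hσσ : ∀ x, σ (σ x) = x := conjLocal_conjLocal (IsCMField.complexConj L) v (GelbartRogawski1991.UnitaryDualPair.complexConj_imagUnit L)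
    (GelbartRogawski1991.UnitaryDualPair.imagUnit_ne_zero L)
  have hγU : γ.val ∈ unitaryGroup σ Jv :=
    (Literature.AlgebraicGeometry.ShimuraVarieties.mem_unitaryGroup_iff (σ := σ) (H := Jv) (g := γ.val)).2 ((mem_unitaryGroupOfForm_iff (σ := σ) (J := Jv) (g := γ.val)).1 γ.2)
  set G := twistGram σ Jv P.val with hG
  have hframe : (diagonal fun i => σ (u i)) * G * diagonal u = G := by
    have h1 : twistGram σ Jv (γ.val.val * P.val) = twistGram σ Jv P.val := twistGram_unitary_mul σ Jv hγU _
    rwa [hP, twistGram_mul, diagonal_map (map_zero σ), diagonal_transpose] at h1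
  have hdiag : ∀ i, (σ (u i) * u i - 1) * G i i = 0 := fun i => by
    have h := congrFun (congrFun hframe i) i
    rw [mul_diagonal, diagonal_mul] at h
    linear_combination h
  have hdetγ : σ γ.val.val.det * γ.val.val.det = 1 :=
    map_det_mul_det_eq_one_of_unitary σ hJvd.ne_zero ((Literature.AlgebraicGeometry.ShimuraVarieties.mem_unitaryGroup_iff (σ := σ) (H := Jv) (g := γ.val)).1 hγU)
  have hdetu : γ.val.val.det = u 0 * u 1 := by
    have h := congrArg Matrix.det hP
    rw [Matrix.det_mul, Matrix.det_mul, det_diagonal, Fin.prod_univ_two] at h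
    have hPd : P.val.det ≠ 0 := by
      have hh := P.isUnit; rw [Matrix.isUnit_iff_isUnit_det] at hh; exact hh.ne_zero
    have h' : P.val.det * γ.val.val.det = P.val.det * (u 0 * u 1) := by rw [mul_comm P.val.det γ.val.val.det, h]
    exact mul_left_cancel₀ hPd h'
  have h1 : σ (u 1) * u 1 ≠ 1 := by
    intro h1
    apply h0
    rw [hdetu, map_mul] at hdetγ
    calc σ (u 0) * u 0 = σ (u 0) * u 0 * (σ (u 1) * u 1) := by rw [h1, mul_one]
      _ = σ (u 0) * σ (u 1) * (u 0 * u 1) := by ring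
      _ = 1 := hdetγ
  have hG00 : G 0 0 = 0 := (mul_eq_zero.1 (hdiag 0)).resolve_left (sub_ne_zero.2 h0)
  have hG11 : G 1 1 = 0 := (mul_eq_zero.1 (hdiag 1)).resolve_left (sub_ne_zero.2 h1)
  have hmemZ : ∀ t : LocalRing L v, t ≠ 0 → ∃ z : (cmDatum L 2 J).Local v, z ∈ Subgroup.centralizer ({γ} : Set ((cmDatum L 2 J).Local v)) ∧
      ((P⁻¹).val * z.val.val * P.val) 0 0 = t := by
    intro t ht
    have hσt : σ t ≠ 0 := (map_ne_zero σ).2 ht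
    have hσtu : IsUnit (σ t) := Ne.isUnit hσt
    set s : LocalRing L v := ↑(hσtu.unit⁻¹) with hsdef
    have hts : σ t * s = 1 := hσtu.mul_val_inv
    have hst : σ s * t = 1 := by
      have h := congrArg σ hts
      rwa [map_mul, hσσ, map_one, mul_comm] at h
    have hs0 : s ≠ 0 := fun h0 => by rw [h0, mul_zero] at hts; exact zero_ne_one hts
    set d : Fin 2 → LocalRing L v := ![t, s] with hd
    have hd0 : d 0 = t := rfl
    have hd1 : d 1 = s := rfl
    have hDdet : (diagonal d).det ≠ 0 := by
      rw [det_diagonal, Fin.prod_univ_two, hd0, hd1]; exact mul_ne_zero ht hs0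
    set D : GL (Fin 2) (LocalRing L v) := Matrix.GeneralLinearGroup.mkOfDetNeZero (diagonal d) hDdet with hDdef
    have hDval : D.val = diagonal d := rfl
    -- unitarity in the frame: `ᵗσ(D) G D = G`
    have hDG : (diagonal fun i => σ (d i)) * G * diagonal d = G := by
      refine Matrix.ext fun i j => ?_
      rw [mul_diagonal, diagonal_mul]
      fin_cases i <;> fin_cases j <;> simp only [Fin.zero_eta, Fin.mk_one, Fin.isValue, hd0, hd1]
      · rw [hG00, mul_zero, zero_mul]
      · rw [mul_assoc, mul_comm (G 0 1), ← mul_assoc, hts, one_mul]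
      · rw [mul_assoc, mul_comm (G 1 0), ← mul_assoc, hst, one_mul]
      · rw [hG11, mul_zero, zero_mul]
    have hzU : P * D * P⁻¹ ∈ unitaryGroup σ Jv := by
      rw [← twistGram_coe_eq_iff_mem_unitaryGroup, Units.val_mul, Units.val_mul, twistGram_mul σ Jv (P.val * D.val) (P⁻¹).val]
      have hPD : twistGram σ Jv (P.val * D.val) = G := by
        rw [twistGram_mul, hDval, diagonal_map (map_zero σ), diagonal_transpose, ← hG, hDG]
      rw [hPD, hG, ← twistGram_mul, ← Units.val_mul, mul_inv_cancel, Units.val_one, twistGram_one]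
    have hzC : Commute (P * D * P⁻¹).val γ.val.val := by
      rw [Units.val_mul, Units.val_mul, hDval]
      exact commute_eigenframe_diagonal hP d
    refine ⟨⟨P * D * P⁻¹, (mem_unitaryGroupOfForm_iff (σ := σ) (J := Jv) (g := P * D * P⁻¹)).2
        ((Literature.AlgebraicGeometry.ShimuraVarieties.mem_unitaryGroup_iff (σ := σ) (H := Jv) (g := P * D * P⁻¹)).1 hzU)⟩, ?_, ?_⟩
    · refine Subgroup.mem_centralizer_iff.2 fun x hx => ?_
      rw [Set.mem_singleton_iff] at hx
      subst hx
      exact Subtype.ext (Units.ext hzC.symm)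
    · show ((P⁻¹).val * (P * D * P⁻¹).val * P.val) 0 0 = t
      rw [Units.val_mul, Units.val_mul, hDval]
      have e : (P⁻¹).val * (P.val * diagonal d * (P⁻¹).val) * P.val = diagonal d := by
        calc (P⁻¹).val * (P.val * diagonal d * (P⁻¹).val) * P.val = ((P⁻¹).val * P.val) * diagonal d * ((P⁻¹).val * P.val) := by
              simp only [Matrix.mul_assoc]
          _ = diagonal d := by rw [← Units.val_mul, inv_mul_cancel, Units.val_one, Matrix.one_mul, Matrix.mul_one]
      rw [e, diagonal_apply_eq, hd0]
  -- the continuous map `z ↦ ((P⁻¹ z P)₀₀)_w` onto a set containing `L_w ∖ {0}`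
  let f : Subgroup.centralizer ({γ} : Set ((cmDatum L 2 J).Local v)) → w.1.adicCompletion L :=
    fun z => (((P⁻¹).val * z.1.val.val * P.val) 0 0) w
  have hf : Continuous f := by
    have h1 : Continuous fun z : Subgroup.centralizer ({γ} : Set ((cmDatum L 2 J).Local v)) => z.1.val.val :=
      (Units.continuous_val.comp continuous_subtype_val).comp continuous_subtype_val
    exact (continuous_apply w).comp (((continuous_const.matrix_mul h1).matrix_mul continuous_const).matrix_elem 0 0)
  have hcover : (Set.univ : Set (w.1.adicCompletion L)) ⊆ Set.range f ∪ {0} := by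
    intro s _
    by_cases hs : s = 0
    · exact Or.inr hs
    · left
      -- lift `s` to the unit `t = (s)_w` of `L_v = L_w`
      set t : LocalRing L v := Pi.single w s with htdef
      have ht : t ≠ 0 := fun h0 => hs (by have h := congrFun h0 w; rwa [htdef, Pi.single_eq_same] at h)
      obtain ⟨z, hz, hzt⟩ := hmemZ t ht
      refine ⟨⟨z, hz⟩, ?_⟩
      show (((P⁻¹).val * z.val.val * P.val) 0 0) w = s
      rw [hzt, htdef, Pi.single_eq_same]
  have hK : IsCompact (Set.range f ∪ {0}) := (isCompact_range hf).union isCompact_singleton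
  haveI : CompactSpace (w.1.adicCompletion L) := ⟨hK.of_isClosed_subset isClosed_univ hcover⟩
  exact not_compactSpace_of_isNonarchimedeanLocalField'' (K := w.1.adicCompletion L) inferInstance

end CM

end Literature.NumberTheory.Automorphic.UnitaryGroup

end
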